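import Summits.NavierStokesRegularity.FluidComputer.AngularGalerkinLadderDivergence
import Summits.NavierStokesRegularity.FluidComputer.AngularGalerkinLadderLinearFlows
import Summits.NavierStokesRegularity.NavierStokesRegularity.Theorems.RungBlowupCofinal.Negative.MeanWaveFoldRange
import HarnessLib

/-!
# The sectoral solid harmonics `(x₀ + i x₁)^m` on the angular Galerkin ladder: they are annihilated
# by the raising operator, so their scalar Casimir is `m(m+1)` and `K₂² = −m²`; their gradient
# fields are exact `𝒞`-eigenfields, `m`-fold azimuthal waves, band-limited of degree `≤ m`
# (route `AngularGalerkinLadder`, crux K1 `RungBlowupCofinal`; kinematic helper, theorems only)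

Cell `ns-blowup`, seat `ns-blowup-circuit` (g11, AGL Lean seat). Helper file for
`stmt-NavierStokesRegularity-19959` serving line `Cruxes/RungBlowupCofinal/Lines/qlwave.lean`, FIRST
PROVER TARGET (S1) «kinematic non-vacuity of the mean–wave sector at every level» — part 2 of 3
(`ToroidalLift.lean`, this file, `SectoralToroidalWaves.lean`). LABEL: KERNEL kinematics. Nothing
here asserts a Theses declaration; no definition, no named fact. WHAT THIS IS NOT: not
Navier–Stokes evidence — calculus of explicit polynomial scalar fields on `ℝ³` and of their
gradients in the vocabulary of `FluidComputer/AngularGalerkinLadder.lean`; no rung dynamics.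

## Content

Throughout `ℓ : ℝ³ →L[ℝ] ℂ` is a real-linear functional; the witnesses use `ℓ(y) = y₀ + i y₁`
(`SectoralToroidalWaves.exists_sectoral_functional`), for which `ℓ(e₂ × y) = iℓ(y)` (hypothesis
`h2`) and `Σ_a ℓ(e_a × y)² = −ℓ(y)²` (hypothesis `hs`). The scalar rotation derivatives are written,
as in the tree's `angGen_gradient` / `casimir_gradient`, as `K_a φ = (y ↦ −Dφ(y)(e_a × y))`.

* §1 `fderiv_clm_pow_apply` (`D(ℓ^m)(y)w = m ℓ(y)^{m−1} ℓ(w)`), **`scalarRot_two_clm_pow`**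
  (`K₂ ℓ^m = −i m ℓ^m`), `scalarRot_scalarRot_clm_pow` (closed form of `K_aK_a ℓ^m`),
  **`scalarCasimir_clm_pow`**: `−Σ_a K_aK_a ℓ^m = m(m+1) ℓ^m` — the sectoral harmonic is a lowest /
  highest weight vector (`(K₀ + iK₁)ℓ^m = 0` is the content of `hs`), so `𝒞_s = m(m+1)`; real parts:
  `scalarRot_two_re_clm_pow` (`K₂ Re ℓ^m = m Im ℓ^m`), `scalarRot_two_im_clm_pow`,
  **`scalarCasimir_re_clm_pow`** (`𝒞_s Re ℓ^m = m(m+1) Re ℓ^m`); `fderiv_re_apply` /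
  `fderiv_im_apply` (real parts commute with real derivatives).
* §2 the gradient fields `∇Re ℓ^m`, `∇Im ℓ^m` (tree `angGen_gradient`, `casimir_gradient`):
  **`angGen_two_gradient_re`** (`J₃∇Re ℓ^m = m ∇Im ℓ^m`), `angGen_two_gradient_im`,
  **`wave_gradient_re`** (`J₃²∇Re ℓ^m = −m² ∇Re ℓ^m`: an `m`-fold azimuthal wave in the letter of
  `Qlwave.IsAzimuthalWave`), **`casimir_gradient_re`** (`𝒞 ∇Re ℓ^m = m(m+1) ∇Re ℓ^m`),
  **`isBandLimited_gradient_re`** (`∇Re ℓ^m` is band-limited of degree `≤ m`: the degree-`m` band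
  defect of a `𝒞`-eigenfield of eigenvalue `m(m+1)` carries the vanishing factor `j = m`,
  K5-74 `bandDefect_eq_smul_of_casimir_eq`).

[cite: BullardGellman1954] (solid harmonics `r^m Y_{mm} ∝ (x + iy)^m`, sectoral `|m| = j`; here
projection-free, in the tree's Casimir-cut typing).
-/

noncomputable section

namespace Summit.NavierStokesRegularity.AngularGalerkinLadderSectoralHarmonics

open Set Function Complex
open scoped ContDiff RealInnerProductSpace
open Literature.Analysis.FluidPDE
open Summit.NavierStokesRegularity.FluidComputer
open Summit.NavierStokesRegularity.FluidComputer.AngularLadder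

/-! ## §1 The complex sectoral solid harmonics `(ℓ x)^m`, `ℓ x = x₀ + i x₁`, and the scalar
rotation derivatives `K_a φ = −Dφ(·)(e_a × ·)` -/

section Scalar

variable (ℓ : EuclideanSpace ℝ (Fin 3) →L[ℝ] ℂ)

/-- `Σ_a e_a × (e_a × y) = −2y`. [folklore] -/
theorem sum_crossCLM_crossCLM_axis (y : EuclideanSpace ℝ (Fin 3)) :
    ∑ a : Fin 3, crossCLM (axis a) (crossCLM (axis a) y) = -((2 : ℝ) • y) := by
  rw [Fin.sum_univ_three]
  apply PiLp.ext
  intro i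
  fin_cases i <;> simp [crossCLM_apply, cross, cross_apply, axis_apply] <;> ring

/-- `Σ_a ℓ(e_a × (e_a × y)) = −2 ℓ(y)` for every real-linear `ℓ : ℝ³ → ℂ`. [folklore] -/
theorem sum_clm_crossCLM_crossCLM_axis (y : EuclideanSpace ℝ (Fin 3)) :
    ∑ a : Fin 3, ℓ (crossCLM (axis a) (crossCLM (axis a) y)) = -2 * ℓ y := by
  rw [← map_sum, sum_crossCLM_crossCLM_axis, map_neg, map_smul, Complex.real_smul]
  push_cast
  ring

/-- `D((ℓ ·)^m)(y) w = m (ℓ y)^{m−1} ℓ(w)`. [folklore] -/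
theorem fderiv_clm_pow_apply (m : ℕ) (y w : EuclideanSpace ℝ (Fin 3)) :
    fderiv ℝ (fun z => (ℓ z) ^ m) y w = (m : ℂ) * (ℓ y) ^ (m - 1) * ℓ w := by
  rw [((ℓ.hasFDerivAt).pow m).fderiv]
  simp only [FunLike.coe_smul, Pi.smul_apply, smul_eq_mul, nsmul_eq_mul]

/-- `(ℓ ·)^m` is differentiable. [folklore] -/
theorem differentiable_clm_pow (m : ℕ) : Differentiable ℝ fun z => (ℓ z) ^ m :=
  fun y => ((ℓ.hasFDerivAt (x := y)).pow m).differentiableAt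

/-- `(ℓ ·)^m` is smooth. [folklore] -/
theorem contDiff_clm_pow (m : ℕ) : ContDiff ℝ ∞ fun z => (ℓ z) ^ m :=
  ℓ.contDiff.pow m

/-- **The sectoral harmonic is a `K₂`-eigenfunction**: if `ℓ(e₂ × y) = i ℓ(y)` then
`K₂ (ℓ ·)^m = −i m (ℓ ·)^m`. [folklore] -/
theorem scalarRot_two_clm_pow (h2 : ∀ y, ℓ (crossCLM (axis 2) y) = I * ℓ y) (m : ℕ)
    (y : EuclideanSpace ℝ (Fin 3)) :
    -fderiv ℝ (fun z => (ℓ z) ^ m) y (crossCLM (axis 2) y) = -(I * m) * (ℓ y) ^ m := by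
  rw [fderiv_clm_pow_apply, h2]
  rcases m with _ | k
  · simp
  · simp only [Nat.add_sub_cancel, pow_succ, Nat.cast_succ]
    ring

/-- The closed form of `K_a (ℓ ·)^m`: `K_a (ℓ ·)^m (z) = −m (ℓ z)^{m−1} ℓ(e_a × z)`. [folklore] -/
theorem scalarRot_clm_pow_eq (m : ℕ) (a : Fin 3) :
    (fun z => -fderiv ℝ (fun w => (ℓ w) ^ m) z (crossCLM (axis a) z)) =
      fun z => -(m : ℂ) * ((ℓ z) ^ (m - 1) * (ℓ.comp (crossCLM (axis a))) z) := by
  funext z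
  rw [fderiv_clm_pow_apply]
  simp only [ContinuousLinearMap.coe_comp, Function.comp_apply]
  ring

/-- `K_a (ℓ ·)^m` is differentiable, with derivative from the product rule. [folklore] -/
theorem hasFDerivAt_scalarRot_clm_pow (m : ℕ) (a : Fin 3) (y : EuclideanSpace ℝ (Fin 3)) :
    HasFDerivAt (fun z => -fderiv ℝ (fun w => (ℓ w) ^ m) z (crossCLM (axis a) z))
      (-(m : ℂ) • ((ℓ y) ^ (m - 1) • ℓ.comp (crossCLM (axis a)) +
        (ℓ.comp (crossCLM (axis a))) y • ((((m - 1 : ℕ) : ℕ) • (ℓ y) ^ (m - 1 - 1)) • ℓ))) y := by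
  rw [scalarRot_clm_pow_eq]
  exact (((ℓ.hasFDerivAt (x := y)).pow (m - 1)).mul
    ((ℓ.comp (crossCLM (axis a))).hasFDerivAt)).const_mul (-(m : ℂ))

/-- `K_a K_a (ℓ ·)^m (y) = m [ (ℓ y)^{m−1} ℓ(e_a × (e_a × y)) + (m−1) (ℓ y)^{m−2} ℓ(e_a × y)² ]`.
[folklore] -/
theorem scalarRot_scalarRot_clm_pow (m : ℕ) (a : Fin 3) (y : EuclideanSpace ℝ (Fin 3)) :
    -fderiv ℝ (fun z => -fderiv ℝ (fun w => (ℓ w) ^ m) z (crossCLM (axis a) z)) y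
        (crossCLM (axis a) y) =
      (m : ℂ) * ((ℓ y) ^ (m - 1) * ℓ (crossCLM (axis a) (crossCLM (axis a) y)) +
        ((m - 1 : ℕ) : ℂ) * (ℓ y) ^ (m - 1 - 1) * (ℓ (crossCLM (axis a) y)) ^ 2) := by
  rw [(hasFDerivAt_scalarRot_clm_pow ℓ m a y).fderiv]
  simp only [FunLike.coe_smul, FunLike.coe_add, Pi.smul_apply,
    Pi.add_apply, ContinuousLinearMap.coe_comp, Function.comp_apply, smul_eq_mul, nsmul_eq_mul]
  ring

/-- **The scalar Casimir of the sectoral harmonic**: if `Σ_a ℓ(e_a × y)² = −ℓ(y)²` then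
`𝒞_s (ℓ ·)^m = −Σ_a K_a K_a (ℓ ·)^m = m(m+1) (ℓ ·)^m`. [folklore] -/
theorem scalarCasimir_clm_pow (hs : ∀ y, ∑ a : Fin 3, (ℓ (crossCLM (axis a) y)) ^ 2 = -(ℓ y) ^ 2)
    (m : ℕ) (y : EuclideanSpace ℝ (Fin 3)) :
    -∑ a : Fin 3, -fderiv ℝ (fun z => -fderiv ℝ (fun w => (ℓ w) ^ m) z (crossCLM (axis a) z)) y
        (crossCLM (axis a) y) = (m : ℂ) * ((m : ℂ) + 1) * (ℓ y) ^ m := by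
  simp only [scalarRot_scalarRot_clm_pow]
  rw [← Finset.mul_sum, Finset.sum_add_distrib, ← Finset.mul_sum, ← Finset.mul_sum,
    sum_clm_crossCLM_crossCLM_axis, hs]
  rcases m with _ | _ | k
  · simp
  · norm_num
  · simp only [Nat.add_sub_cancel, Nat.cast_succ, pow_succ]
    ring

/-- Real parts commute with real Fréchet derivatives. [folklore] -/
theorem fderiv_re_apply {G : EuclideanSpace ℝ (Fin 3) → ℂ} {y : EuclideanSpace ℝ (Fin 3)}
    (hG : DifferentiableAt ℝ G y) (w : EuclideanSpace ℝ (Fin 3)) :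
    fderiv ℝ (fun z => (G z).re) y w = (fderiv ℝ G y w).re := by
  have h : HasFDerivAt (fun z => (G z).re) (reCLM.comp (fderiv ℝ G y)) y :=
    reCLM.hasFDerivAt.comp y hG.hasFDerivAt
  rw [h.fderiv]
  rfl

/-- Imaginary parts commute with real Fréchet derivatives. [folklore] -/
theorem fderiv_im_apply {G : EuclideanSpace ℝ (Fin 3) → ℂ} {y : EuclideanSpace ℝ (Fin 3)}
    (hG : DifferentiableAt ℝ G y) (w : EuclideanSpace ℝ (Fin 3)) :
    fderiv ℝ (fun z => (G z).im) y w = (fderiv ℝ G y w).im := by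
  have h : HasFDerivAt (fun z => (G z).im) (imCLM.comp (fderiv ℝ G y)) y :=
    imCLM.hasFDerivAt.comp y hG.hasFDerivAt
  rw [h.fderiv]
  rfl

/-- `K₂ Re(ℓ ·)^m = m · Im(ℓ ·)^m`. [folklore] -/
theorem scalarRot_two_re_clm_pow (h2 : ∀ y, ℓ (crossCLM (axis 2) y) = I * ℓ y) (m : ℕ)
    (y : EuclideanSpace ℝ (Fin 3)) :
    -fderiv ℝ (fun z => ((ℓ z) ^ m).re) y (crossCLM (axis 2) y) = (m : ℝ) * ((ℓ y) ^ m).im := by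
  rw [fderiv_re_apply ((differentiable_clm_pow ℓ m) y), ← Complex.neg_re,
    scalarRot_two_clm_pow ℓ h2 m y]
  simp

/-- `K₂ Im(ℓ ·)^m = −m · Re(ℓ ·)^m`. [folklore] -/
theorem scalarRot_two_im_clm_pow (h2 : ∀ y, ℓ (crossCLM (axis 2) y) = I * ℓ y) (m : ℕ)
    (y : EuclideanSpace ℝ (Fin 3)) :
    -fderiv ℝ (fun z => ((ℓ z) ^ m).im) y (crossCLM (axis 2) y) = (-(m : ℝ)) * ((ℓ y) ^ m).re := by
  rw [fderiv_im_apply ((differentiable_clm_pow ℓ m) y), ← Complex.neg_im,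
    scalarRot_two_clm_pow ℓ h2 m y]
  simp

/-- **The scalar Casimir of the real sectoral harmonic**: `𝒞_s Re(ℓ ·)^m = m(m+1) Re(ℓ ·)^m` — in
the letters of the tree's `casimir_gradient`. [folklore] -/
theorem scalarCasimir_re_clm_pow
    (hs : ∀ y, ∑ a : Fin 3, (ℓ (crossCLM (axis a) y)) ^ 2 = -(ℓ y) ^ 2) (m : ℕ)
    (y : EuclideanSpace ℝ (Fin 3)) :
    -∑ a : Fin 3, -fderiv ℝ (fun z => -fderiv ℝ (fun w => ((ℓ w) ^ m).re) z (crossCLM (axis a) z)) y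
        (crossCLM (axis a) y) = ((m : ℝ) * ((m : ℝ) + 1)) * ((ℓ y) ^ m).re := by
  have hin : ∀ a : Fin 3, (fun z => -fderiv ℝ (fun w => ((ℓ w) ^ m).re) z (crossCLM (axis a) z)) =
      fun z => (-fderiv ℝ (fun w => (ℓ w) ^ m) z (crossCLM (axis a) z)).re := fun a => by
    funext z
    rw [fderiv_re_apply ((differentiable_clm_pow ℓ m) z), Complex.neg_re]
  have hd : ∀ a : Fin 3, DifferentiableAt ℝ
      (fun z => -fderiv ℝ (fun w => (ℓ w) ^ m) z (crossCLM (axis a) z)) y :=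
    fun a => (hasFDerivAt_scalarRot_clm_pow ℓ m a y).differentiableAt
  have hout : ∀ a : Fin 3, -fderiv ℝ (fun z => (-fderiv ℝ (fun w => (ℓ w) ^ m) z
      (crossCLM (axis a) z)).re) y (crossCLM (axis a) y) =
      (-fderiv ℝ (fun z => -fderiv ℝ (fun w => (ℓ w) ^ m) z (crossCLM (axis a) z)) y
        (crossCLM (axis a) y)).re := fun a => by
    rw [fderiv_re_apply (hd a), Complex.neg_re]
  simp only [hin, hout]
  rw [← Complex.re_sum, ← Complex.neg_re, scalarCasimir_clm_pow ℓ hs m y]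
  simp only [Complex.mul_re, Complex.add_re, Complex.natCast_re, Complex.one_re, Complex.add_im,
    Complex.natCast_im, Complex.one_im, Complex.mul_im]
  ring

end Scalar

/-! ## §2 Gradient fields of the real sectoral harmonics: exact `𝒞`- and `J₃²`-eigenfields -/

section Gradient

variable {φ : EuclideanSpace ℝ (Fin 3) → ℝ}

/-- The gradient field of a smooth function is smooth. [folklore] -/
private theorem contDiff_gradient (hφ : ContDiff ℝ ∞ φ) : ContDiff ℝ ∞ (gradient φ) := by
  set Lr : (EuclideanSpace ℝ (Fin 3) →L[ℝ] ℝ) →L[ℝ] EuclideanSpace ℝ (Fin 3) :=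
    (InnerProductSpace.toDual ℝ (EuclideanSpace ℝ (Fin 3))).symm.toContinuousLinearEquiv.toContinuousLinearMap
    with hLr
  have h1 : gradient φ = fun y => Lr (fderiv ℝ φ y) := rfl
  rw [h1]
  exact Lr.contDiff.comp (contDiff_infty_iff_fderiv.1 hφ).2

/-- `∇(c φ) = c ∇φ`. [folklore] -/
private theorem gradient_const_mul (hφ : Differentiable ℝ φ) (c : ℝ) :
    gradient (fun y => c * φ y) = fun y => c • gradient φ y := by
  funext y
  refine ext_inner_right ℝ fun w => ?_
  rw [inner_gradient_left, real_inner_smul_left, inner_gradient_left, fderiv_const_mul (hφ y) c]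
  simp only [FunLike.coe_smul, Pi.smul_apply, smul_eq_mul]

variable (ℓ : EuclideanSpace ℝ (Fin 3) →L[ℝ] ℂ)

/-- The real and imaginary sectoral harmonics are smooth. [folklore] -/
theorem contDiff_re_clm_pow (m : ℕ) : ContDiff ℝ ∞ fun z => ((ℓ z) ^ m).re :=
  reCLM.contDiff.comp (contDiff_clm_pow ℓ m)

/-- The imaginary sectoral harmonic is smooth. [folklore] -/
theorem contDiff_im_clm_pow (m : ℕ) : ContDiff ℝ ∞ fun z => ((ℓ z) ^ m).im :=
  imCLM.contDiff.comp (contDiff_clm_pow ℓ m)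

/-- **`J₃ ∇Re(ℓ ·)^m = m ∇Im(ℓ ·)^m`** (if `ℓ(e₂ × y) = iℓ(y)`): the generators map gradients to
gradients of the scalar rotation derivative (tree `angGen_gradient`). [folklore] -/
theorem angGen_two_gradient_re (h2 : ∀ y, ℓ (crossCLM (axis 2) y) = I * ℓ y) (m : ℕ) :
    angGen 2 (gradient fun z => ((ℓ z) ^ m).re) =
      fun y => (m : ℝ) • gradient (fun z => ((ℓ z) ^ m).im) y := by
  rw [angGen_gradient (contDiff_re_clm_pow ℓ m) 2]
  have h : (fun y => -fderiv ℝ (fun z => ((ℓ z) ^ m).re) y (crossCLM (axis 2) y)) =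
      fun y => (m : ℝ) * ((ℓ y) ^ m).im := funext fun y => scalarRot_two_re_clm_pow ℓ h2 m y
  rw [h, gradient_const_mul ((contDiff_im_clm_pow ℓ m).differentiable (by simp))]

/-- **`J₃ ∇Im(ℓ ·)^m = −m ∇Re(ℓ ·)^m`**. [folklore] -/
theorem angGen_two_gradient_im (h2 : ∀ y, ℓ (crossCLM (axis 2) y) = I * ℓ y) (m : ℕ) :
    angGen 2 (gradient fun z => ((ℓ z) ^ m).im) =
      fun y => (-(m : ℝ)) • gradient (fun z => ((ℓ z) ^ m).re) y := by
  rw [angGen_gradient (contDiff_im_clm_pow ℓ m) 2]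
  have h : (fun y => -fderiv ℝ (fun z => ((ℓ z) ^ m).im) y (crossCLM (axis 2) y)) =
      fun y => (-(m : ℝ)) * ((ℓ y) ^ m).re := funext fun y => scalarRot_two_im_clm_pow ℓ h2 m y
  rw [h, gradient_const_mul ((contDiff_re_clm_pow ℓ m).differentiable (by simp))]

/-- **The gradient of the real sectoral harmonic is an `m`-fold azimuthal wave**:
`J₃(J₃ ∇Re(ℓ ·)^m) = −m² ∇Re(ℓ ·)^m`. [folklore] -/
theorem wave_gradient_re (h2 : ∀ y, ℓ (crossCLM (axis 2) y) = I * ℓ y) (m : ℕ)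
    (y : EuclideanSpace ℝ (Fin 3)) :
    angGen 2 (angGen 2 (gradient fun z => ((ℓ z) ^ m).re)) y =
      -(((m : ℝ) ^ 2) • gradient (fun z => ((ℓ z) ^ m).re) y) := by
  have hd : Differentiable ℝ (gradient fun z => ((ℓ z) ^ m).im) :=
    (contDiff_gradient (contDiff_im_clm_pow ℓ m)).differentiable (by simp)
  rw [angGen_two_gradient_re ℓ h2 m]
  have e : (fun y => (m : ℝ) • gradient (fun z => ((ℓ z) ^ m).im) y) =
      (m : ℝ) • gradient (fun z => ((ℓ z) ^ m).im) := rfl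
  rw [e, angGen_smul hd, Pi.smul_apply, angGen_two_gradient_im ℓ h2 m]
  simp only [neg_smul, smul_neg, smul_smul, sq]

/-- **The gradient of the real sectoral harmonic is an exact `𝒞`-eigenfield**:
`𝒞 ∇Re(ℓ ·)^m = m(m+1) ∇Re(ℓ ·)^m` (if `Σ_a ℓ(e_a × y)² = −ℓ(y)²`). [folklore] -/
theorem casimir_gradient_re
    (hs : ∀ y, ∑ a : Fin 3, (ℓ (crossCLM (axis a) y)) ^ 2 = -(ℓ y) ^ 2) (m : ℕ) :
    casimir (gradient fun z => ((ℓ z) ^ m).re) =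
      ((m : ℝ) * ((m : ℝ) + 1)) • gradient fun z => ((ℓ z) ^ m).re := by
  rw [casimir_gradient (contDiff_re_clm_pow ℓ m)]
  have h : (fun y => -∑ a : Fin 3, -fderiv ℝ (fun z => -fderiv ℝ (fun w => ((ℓ w) ^ m).re) z
      (crossCLM (axis a) z)) y (crossCLM (axis a) y)) =
      fun y => ((m : ℝ) * ((m : ℝ) + 1)) * ((ℓ y) ^ m).re :=
    funext fun y => scalarCasimir_re_clm_pow ℓ hs m y
  rw [h, gradient_const_mul ((contDiff_re_clm_pow ℓ m).differentiable (by simp))]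
  rfl

/-- **The gradient of the real sectoral harmonic of degree `m` is band-limited of degree `≤ m`**:
on a `𝒞`-eigenfield of eigenvalue `m(m+1)` the degree-`m` band defect has the vanishing factor
`j = m`. [folklore] -/
theorem isBandLimited_gradient_re
    (hs : ∀ y, ∑ a : Fin 3, (ℓ (crossCLM (axis a) y)) ^ 2 = -(ℓ y) ^ 2) (m : ℕ) :
    IsBandLimited m (gradient fun z => ((ℓ z) ^ m).re) := by
  have hG : ContDiff ℝ ∞ (gradient fun z => ((ℓ z) ^ m).re) :=
    contDiff_gradient (contDiff_re_clm_pow ℓ m)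
  refine ⟨hG, fun y => ?_⟩
  rw [AngularGalerkinLadderMeanWaveFoldRange.bandDefect_eq_smul_of_casimir_eq hG
    (casimir_gradient_re ℓ hs m) m, Pi.smul_apply]
  have h0 : (∏ j ∈ Finset.range (m + 1), ((m : ℝ) * ((m : ℝ) + 1) - (j : ℝ) * ((j : ℝ) + 1))) = 0 :=
    Finset.prod_eq_zero (Finset.mem_range.2 (Nat.lt_succ_self m)) (sub_self _)
  rw [h0, zero_smul]

end Gradient

end Summit.NavierStokesRegularity.AngularGalerkinLadderSectoralHarmonics

end
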